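import Summits.NavierStokesRegularity.FluidComputer.PalasekTowerGermHostExplicit

/-!
# The germ host, FREE-RUN DOOR, I: shorter fades are certificates; the faded residual is `O(ε)` on
# the fade window, vanishes after it, and is `O(ε)` in `L²`

Cell `ns-blowup`, seat `ns-blowup-ecbridge-3` (g6; D-0074 GROUP C «BRIDGE SUPPORT», lineage
`host_preparation`; bears_on LADDER-NS N1, route `PalasekTowerBreakdown`, crux `EpisodeBase` = item
stmt-NavierStokesRegularity-19179, line `slot` v5, stub `stub_explicit_slice_run : ExplicitSliceRun`).
LABEL: E–C typing (KERNEL: theorems only; no definition, no named fact, no `sorry`). WHAT THIS IS NOT: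
not Navier–Stokes evidence — calculus of the PRESCRIBED host force `lineForce U σ₀ ε` of an explicit germ
design (`Germ.LineGermData`, p-GermHostExplicit); nothing about any flow after `τ₀`.

* `LineGermData.restrictFade` — the certificate with a SHORTER fade `0 < ε ≤ ε₀` is still a certificate;
* `LineGermData.exists_norm_lineForce_le` — ONE constant `L ≥ 0` with `‖lineForce U σ₀ ε (t, x)‖ ≤ L ε`
  on `[1, 1 + ε] × ℝ³` for every `0 < ε ≤ ε₀` (the residual `germResid` of the line germ is jointly smooth,
  vanishes at the matched instant `t = 1` (`germResid_eq_zero_of_matched`) and off `B̄(0, ρ)`: mean value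
  theorem on the compact convex box `[1, 1 + ε₀] × B̄(0, ρ)`; `|fade| ≤ 1`);
* `LineGermData.lineForce_eq_zero_of_ge` — it vanishes from `1 + ε` on;
* `LineGermData.eLpNorm_two_le_of_confined'` — `‖h‖₂ ≤ B |B̄(0, ρ)|^{1/2}` for a field bounded by `B`
  and confined to the ball.

Part II (`PalasekTowerGermHostFreeRun.lean`) feeds these to THE PERTURBED RUN. References: S. Palasek,
arXiv:2605.13827 §3.3 [cite: Palasek2026ElementaryModel, §3.3]; C. L. Fefferman, Clay problem
description (5)–(6) [cite: FeffermanClay2006, (5) (6)].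
-/

noncomputable section

namespace Summit.NavierStokesRegularity.FluidComputer.PalasekTowerClayBridge.Germ

open Set Function Filter Topology InnerProductSpace Metric MeasureTheory
open scoped Topology ContDiff RealInnerProductSpace ENNReal NNReal
open Literature.Analysis.FluidPDE

namespace LineGermData

variable {U : EuclideanSpace ℝ (Fin 3) → EuclideanSpace ℝ (Fin 3)} {ρ σ₀ ε₀ c₄ : ℝ}
  (d : LineGermData U ρ σ₀ ε₀ c₄)
include d

/-! ## §1 Shorter fades; the size of the faded residual -/

/-- The profile has compact support. [folklore] -/
private theorem hasCompactSupport_profile : HasCompactSupport U :=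
  (isCompact_closedBall (0 : EuclideanSpace ℝ (Fin 3)) ρ).of_isClosed_subset (isClosed_tsupport U)
    d.support

/-- **A shorter fade is still a certificate**: `LineGermData U ρ σ₀ ε c₄` for every `0 < ε ≤ ε₀` (the
window bound restricts). [folklore] -/
theorem restrictFade {ε : ℝ} (hε : 0 < ε) (hεε₀ : ε ≤ ε₀) : LineGermData U ρ σ₀ ε c₄ where
  smooth := d.smooth
  support := d.support
  divFree := d.divFree
  ceiling := d.ceiling
  floor := d.floor
  strain := d.strain
  core := d.core
  width_pos := d.width_pos
  line := d.line
  fade_pos := hε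
  fade_le := hεε₀.trans d.fade_le
  push_pos := d.push_pos
  push_le := d.push_le
  window := fun t ht x => d.window t ⟨ht.1, ht.2.trans (by linarith)⟩ x

/-- **The faded residual is `O(ε)` on the fade window and vanishes after it.** There is `L ≥ 0` with:
for every `0 < ε ≤ ε₀`, `‖lineForce U σ₀ ε t x‖ ≤ L ε` for `t ∈ [1, 1 + ε]` and all `x`. (The residual
`germResid` of the line germ is jointly smooth, vanishes at the matched instant `t = 1` and off
`B̄(0, ρ)`; mean value theorem on the compact convex box `[1, 1 + ε₀] × B̄(0, ρ)`; `|fade| ≤ 1`.)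
[folklore] -/
theorem exists_norm_lineForce_le :
    ∃ L : ℝ, 0 ≤ L ∧ ∀ ε : ℝ, 0 < ε → ε ≤ ε₀ →
      ∀ t ∈ Icc (1 : ℝ) (1 + ε), ∀ x, ‖lineForce U σ₀ ε t x‖ ≤ L * ε := by
  set g : ℝ × EuclideanSpace ℝ (Fin 3) → EuclideanSpace ℝ (Fin 3) :=
    uncurry (germResid 1 U αhost (βhost σ₀)) with hg
  have hgs : ContDiff ℝ ∞ g :=
    contDiff_uncurry_germResid d.smooth d.hasCompactSupport_profile contDiff_αhost (contDiff_βhost _)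
  have hgd : ∀ z, DifferentiableAt ℝ g z := fun z => (hgs.differentiable (by simp)) z
  have hgc : Continuous (fderiv ℝ g) := hgs.continuous_fderiv (by simp)
  set K : Set (ℝ × EuclideanSpace ℝ (Fin 3)) :=
    Icc (1 : ℝ) (1 + ε₀) ×ˢ closedBall (0 : EuclideanSpace ℝ (Fin 3)) ρ with hK
  have hKc : IsCompact K := isCompact_Icc.prod (isCompact_closedBall _ _)
  have hKconv : Convex ℝ K := (convex_Icc _ _).prod (convex_closedBall _ _)
  obtain ⟨C, hC⟩ := hKc.exists_bound_of_continuousOn hgc.continuousOn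
  refine ⟨max C 0, le_max_right _ _, fun ε hε hεε₀ t ht x => ?_⟩
  have hres : ‖germResid 1 U αhost (βhost σ₀) t x‖ ≤ max C 0 * (t - 1) := by
    by_cases hx : ‖x‖ ≤ ρ
    · have hx' : x ∈ closedBall (0 : EuclideanSpace ℝ (Fin 3)) ρ := by
        rw [mem_closedBall, dist_zero_right]; exact hx
      have h1K : ((1 : ℝ), x) ∈ K := mk_mem_prod ⟨le_rfl, by linarith [d.fade_pos]⟩ hx'
      have htK : (t, x) ∈ K := mk_mem_prod ⟨ht.1, ht.2.trans (by linarith)⟩ hx'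
      have hmvt := hKconv.norm_image_sub_le_of_norm_fderiv_le (f := g) (C := max C 0) (fun z _ => hgd z)
        (fun z hz => (hC z hz).trans (le_max_left C 0)) h1K htK
      have h0 : g ((1 : ℝ), x) = 0 := by
        show germResid 1 U αhost (βhost σ₀) 1 x = 0
        exact germResid_eq_zero_of_matched αhost_one deriv_αhost_one (βhost_one _)
          (deriv_βhost_one d.width_pos.ne') x
      have hdist : ‖((t, x) : ℝ × EuclideanSpace ℝ (Fin 3)) - ((1 : ℝ), x)‖ = t - 1 := by
        rw [Prod.mk_sub_mk, sub_self, Prod.norm_mk, norm_zero, Real.norm_of_nonneg (by linarith [ht.1]),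
          max_eq_left (by linarith [ht.1])]
      rw [h0, sub_zero, hdist] at hmvt
      exact hmvt
    · rw [not_le] at hx
      rw [germResid_eq_zero_of_norm_gt d.smooth d.hasCompactSupport_profile d.support t hx, norm_zero]
      exact mul_nonneg (le_max_right _ _) (by linarith [ht.1])
  calc ‖lineForce U σ₀ ε t x‖ ≤ ‖germResid 1 U αhost (βhost σ₀) t x‖ := norm_germForce_le t x
    _ ≤ max C 0 * (t - 1) := hres
    _ ≤ max C 0 * ε := mul_le_mul_of_nonneg_left (by linarith [ht.2]) (le_max_right _ _)

omit d in
/-- The faded force vanishes from `1 + ε` on (`ε > 0`). [folklore] -/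
theorem lineForce_eq_zero_of_ge {ε : ℝ} (hε : 0 < ε) {t : ℝ} (ht : 1 + ε ≤ t)
    (x : EuclideanSpace ℝ (Fin 3)) : lineForce U σ₀ ε t x = 0 :=
  germForce_eq_zero_of_ge hε ht x

omit d in
/-- **`L²` size of a bounded field confined to the ball**: `‖h‖ ≤ B` and `h = 0` off `B̄(0, ρ)` give
`‖h‖₂ ≤ B · (|B̄(0, ρ)|)^{1/2}` (with the real volume of the ball). [folklore] -/
theorem eLpNorm_two_le_of_confined' {h : EuclideanSpace ℝ (Fin 3) → EuclideanSpace ℝ (Fin 3)} {B : ℝ}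
    (hbd : ∀ y, ‖h y‖ ≤ B) (hconf : ∀ y, ρ < ‖y‖ → h y = 0) :
    eLpNorm h 2 volume ≤
      ENNReal.ofReal (B * Real.sqrt (volume (closedBall (0 : EuclideanSpace ℝ (Fin 3)) ρ)).toReal) := by
  have hsupp : Function.support h ⊆ closedBall (0 : EuclideanSpace ℝ (Fin 3)) ρ := by
    intro y hy
    rw [mem_closedBall, dist_zero_right]
    by_contra hlt
    exact hy (hconf y (not_le.1 hlt))
  rw [← eLpNorm_restrict_eq_of_support_subset hsupp]
  have hb : ∀ᵐ y ∂(volume.restrict (closedBall (0 : EuclideanSpace ℝ (Fin 3)) ρ)), ‖h y‖ ≤ B :=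
    Eventually.of_forall fun y => hbd y
  refine (eLpNorm_le_of_ae_bound hb).trans (le_of_eq ?_)
  have hfin : volume (closedBall (0 : EuclideanSpace ℝ (Fin 3)) ρ) ≠ ⊤ := measure_closedBall_lt_top.ne
  rw [Measure.restrict_apply_univ, ENNReal.toReal_ofNat]
  have hpow : volume (closedBall (0 : EuclideanSpace ℝ (Fin 3)) ρ) ^ ((2 : ℝ)⁻¹) =
      ENNReal.ofReal ((volume (closedBall (0 : EuclideanSpace ℝ (Fin 3)) ρ)).toReal ^ ((2 : ℝ)⁻¹)) := by
    rw [← ENNReal.ofReal_rpow_of_nonneg ENNReal.toReal_nonneg (by norm_num), ENNReal.ofReal_toReal hfin]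
  rw [hpow, ← ENNReal.ofReal_mul (Real.rpow_nonneg ENNReal.toReal_nonneg _), Real.sqrt_eq_rpow,
    one_div, mul_comm]

end LineGermData

end Summit.NavierStokesRegularity.FluidComputer.PalasekTowerClayBridge.Germ

end
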